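import Literature.Probability.RandomPlanarGeometry.HexSAWBrickWallStripFugacityWidthOneLinearContactCLT
import HarnessLib

/-!
# The JOINT central limit theorem of the two contact numbers of the width-one strip:
# `((bc − N b)/√N, (tc − N b')/√N) ⇒ N(0, M⁻¹)` on `ℝ²`, `M⁻¹` = the Hessian of the free energy

Topic `Literature/Probability/RandomPlanarGeometry` (continues `…WidthOneLinearContactCLT.lean` (★★★★ `tendsto_linLaw`: for EVERY direction `v`, the law of
`(v₁bc + v₂tc − N m_v)/√N` converges weakly to `N(0, H_{y,z}(v))` — the Cramér–Wold projections) and `…WidthOneLinearContactStatistics.lean`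
(`contactHess`, `contactHess_pos`, `contactHess_axes`)).  THIS FILE assembles the projections into the two-dimensional statement, with Mathlib's
multivariate Gaussian `ProbabilityTheory.multivariateGaussian` on `EuclideanSpace ℝ (Fin 2)` and Lévy's convergence theorem on finite-dimensional inner
product spaces (`ProbabilityMeasure.tendsto_of_tendsto_charFun`): the characteristic function of the joint law at `ξ` IS the characteristic function of the
projected law of `⟨ξ, ·⟩` at `1`, so the one-dimensional limits give `e^{−H(ξ)/2} = e^{−ξ·Σξ/2}`, the characteristic function of `N(0, Σ)`,
`Σ = M⁻¹ = [[∂b/∂A, ∂b/∂B], [∂b/∂B, ∂b'/∂B]]` (Cramér–Wold device).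

* §1 `finLawOn` (finitely supported laws on any measurable space; `integral_finLawOn`, `isProbabilityMeasure_finLawOn`), `integral_finLaw'`
  (vector-valued integrals against the one-dimensional `finLaw`).
* §2 `contactCov y z` — the covariance MATRIX `Σ = [[H(1,0), Σ₁₂], [Σ₁₂, H(0,1)]]`, `Σ₁₂ = (H(1,1) − H(1,0) − H(0,1))/2`; `contactCov_quadForm`
  (`ξ ⬝ᵥ Σ ξ = H(ξ)`), `posSemidef_contactCov`, `contactCov_entries` (`Σ₁₁ = ∂b/∂A`, `Σ₂₂ = ∂b(e^B,y)/∂B`, `Σ₁₂ = ∂b/∂B < 0`).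
* §3 `jointLaw y z N` (the law of the centred scaled PAIR as a measure on `EuclideanSpace ℝ (Fin 2)`), ★ `charFun_jointLaw` (`= charFun(linLaw ξ₀ ξ₁)(1)`).
* §4 ★★★★ `tendsto_jointLaw` — THE JOINT CLT: `law(((bc − Nb)/√N, (tc − Nb')/√N)) ⟶ multivariateGaussian 0 Σ` weakly; `tendsto_integral_jointLaw`
  (bounded continuous test functions on `ℝ²`).

## Sources
H. Cramér, H. Wold, J. London Math. Soc. 11 (1936) 290–294 (projections determine the law; here via characteristic functions + Lévy); J. H. Curtiss (1942)
Theorem 3; A. Dembo, O. Zeitouni (2010) §2.3 (lane statements); E. J. Janse van Rensburg (2000) §3.3; N. R. Beaton, M. Bousquet-Mélou, J. de Gier,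
H. Duminil-Copin, A. J. Guttmann, CMP 326 (2014), arXiv:1109.0358v5 §3.2 Proposition 6 (p. 10).  Nothing is quoted AS PRINTED; statements are this lineage's.
-/

noncomputable section

open Filter Topology Finset Set MeasureTheory ProbabilityTheory Matrix Complex Literature.Analysis Literature.Probability.Moments
open Literature.Probability.LatticeModels Literature.Probability.Percolation
open scoped RealInnerProductSpace

namespace Literature.Probability.RandomPlanarGeometry.SAW.HexBW

namespace WidthOneYZ

variable {y z : ℝ}

/-! ## §1 Finitely supported laws on a measurable space (plumbing) -/

/-- The law `Σ_{q ∈ S} w(q)·δ_{X(q)}` of a statistic `X` with values in any measurable space. [cite: Durrett2019, §3.2 (distribution of a random vector; lane plumbing)] -/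
def finLawOn {ι α : Type*} [MeasurableSpace α] (S : Finset ι) (w : ι → ℝ) (X : ι → α) : Measure α :=
  ∑ q ∈ S, ENNReal.ofReal (w q) • Measure.dirac (X q)

/-- `∫ f d(finLawOn S w X) = Σ_{q ∈ S} w(q) • f(X q)` for EVERY vector-valued `f` (`w ≥ 0` on `S`). [cite: Durrett2019, §3.2 (lane plumbing)] -/
theorem integral_finLawOn {ι α E : Type*} [MeasurableSpace α] [MeasurableSingletonClass α] [NormedAddCommGroup E] [NormedSpace ℝ E]
    [CompleteSpace E] (S : Finset ι) {w : ι → ℝ} (X : ι → α) (hw : ∀ q ∈ S, 0 ≤ w q) (f : α → E) :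
    ∫ x, f x ∂finLawOn S w X = ∑ q ∈ S, w q • f (X q) := by
  rw [finLawOn, integral_finsetSum_measure fun q _ => (integrable_dirac (by simp)).smul_measure ENNReal.ofReal_ne_top]
  refine Finset.sum_congr rfl fun q hq => ?_
  rw [integral_smul_measure, integral_dirac, ENNReal.toReal_ofReal (hw q hq)]

/-- A finitely supported law with nonnegative weights summing to `1` is a probability measure. [cite: Durrett2019, §3.2 (lane plumbing)] -/
theorem isProbabilityMeasure_finLawOn {ι α : Type*} [MeasurableSpace α] (S : Finset ι) {w : ι → ℝ} (X : ι → α)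
    (hw : ∀ q ∈ S, 0 ≤ w q) (h1 : ∑ q ∈ S, w q = 1) : IsProbabilityMeasure (finLawOn S w X) := by
  refine ⟨?_⟩
  rw [finLawOn, Measure.finsetSum_apply]
  simp only [Measure.smul_apply, measure_univ, smul_eq_mul, mul_one]
  rw [← ENNReal.ofReal_sum_of_nonneg hw, h1, ENNReal.ofReal_one]

/-- Vector-valued integrals against the one-dimensional `finLaw` of CAR «CONTACT CLT»: `∫ f d(finLaw S w X) = Σ_q w(q) • f(X q)`.
[cite: Durrett2019, §3.2 (lane plumbing)] -/
theorem integral_finLaw' {ι E : Type*} [NormedAddCommGroup E] [NormedSpace ℝ E] [CompleteSpace E] (S : Finset ι) {w : ι → ℝ} (X : ι → ℝ)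
    (hw : ∀ q ∈ S, 0 ≤ w q) (f : ℝ → E) : ∫ x, f x ∂finLaw S w X = ∑ q ∈ S, w q • f (X q) := by
  rw [finLaw, integral_finsetSum_measure fun q _ => (integrable_dirac (by simp)).smul_measure ENNReal.ofReal_ne_top]
  refine Finset.sum_congr rfl fun q hq => ?_
  rw [integral_smul_measure, integral_dirac, ENNReal.toReal_ofReal (hw q hq)]

/-! ## §2 The covariance matrix `Σ = M⁻¹` -/

/-- **The limiting covariance matrix of `(bc, tc)/√N`**: `Σ = [[H(1,0), Σ₁₂], [Σ₁₂, H(0,1)]]` with `Σ₁₂ = (H(1,1) − H(1,0) − H(0,1))/2`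
(`= [[m₂₂, −m₁₂], [−m₁₂, m₁₁]]/D = M⁻¹`, the Hessian of the free energy `log μ₁(e^A,e^B)`).
[cite: DemboZeitouni2010, §2.3 (covariance = Hessian of the limiting logarithmic mgf; lane statement); JansevanRensburg2000, §3.3 (1st ed.)] -/
def contactCov (y z : ℝ) : Matrix (Fin 2) (Fin 2) ℝ :=
  !![contactHess 1 0 y z, (contactHess 1 1 y z - contactHess 1 0 y z - contactHess 0 1 y z) / 2;
    (contactHess 1 1 y z - contactHess 1 0 y z - contactHess 0 1 y z) / 2, contactHess 0 1 y z]

/-- `ξ ⬝ᵥ Σ ξ = H_{y,z}(ξ₀, ξ₁)` (a quadratic form is recovered from its polarization). [cite: DemboZeitouni2010, §2.3 (lane plumbing)] -/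
theorem contactCov_quadForm (y z : ℝ) (ξ : Fin 2 → ℝ) : ξ ⬝ᵥ contactCov y z *ᵥ ξ = contactHess (ξ 0) (ξ 1) y z := by
  unfold contactCov contactHess
  simp only [Matrix.mulVec, dotProduct, Fin.sum_univ_two, Matrix.cons_val_zero, Matrix.cons_val_one, Matrix.of_apply,
    Matrix.cons_val', Matrix.empty_val', Matrix.cons_val_fin_one]
  ring

/-- `Σ` is symmetric positive semidefinite (`H(ξ) > 0` for `ξ ≠ 0`). [cite: DemboZeitouni2010, §2.2–§2.3 (lane statement)] -/
theorem posSemidef_contactCov (hy : 0 < y) (hz : 0 < z) : (contactCov y z).PosSemidef := by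
  refine Matrix.PosSemidef.of_dotProduct_mulVec_nonneg ?_ fun ξ => ?_
  · -- symmetric
    rw [Matrix.IsHermitian]
    ext i j
    fin_cases i <;> fin_cases j <;> simp [contactCov]
  · rw [star_trivial, contactCov_quadForm]
    by_cases h : (ξ 0, ξ 1) = ((0 : ℝ), (0 : ℝ))
    · obtain ⟨h0, h1⟩ : ξ 0 = 0 ∧ ξ 1 = 0 := by simpa using h
      rw [h0, h1]
      simp [contactHess]
    · exact (contactHess_pos hy hz h).le

/-- The entries of `Σ`: `Σ₁₁ = ∂b/∂A`, `Σ₂₂ = ∂b(e^B, y)/∂B`, `Σ₁₂ = Σ₂₁ = ∂b/∂B = d/dB b(y,e^B)|_{log z} < 0` (the susceptibilities of the tree).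
[cite: DemboZeitouni2010, §2.3 (lane statement); JansevanRensburg2000, §3.3 (1st ed.)] -/
theorem contactCov_entries (hy : 0 < y) (hz : 0 < z) :
    contactCov y z 0 0 = deriv (fun A => contactB (Real.exp A) z) (Real.log y) ∧
    contactCov y z 1 1 = deriv (fun B => contactB (Real.exp B) y) (Real.log z) ∧
    contactCov y z 0 1 = deriv (fun B => contactB y (Real.exp B)) (Real.log z) ∧
    contactCov y z 1 0 = contactCov y z 0 1 ∧ contactCov y z 0 1 < 0 := by
  obtain ⟨e1, e2, e3⟩ := contactHess_axes hy hz
  obtain ⟨-, hneg⟩ := tendsto_covContacts_div_explicit hy hz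
  obtain ⟨-, -, -, dB, -, -, -⟩ := hasDerivAt_contactB_log (Real.log y) (Real.log z)
  simp only [Real.exp_log hy, Real.exp_log hz] at dB
  have e01 : contactCov y z 0 1 = deriv (fun B => contactB y (Real.exp B)) (Real.log z) := by
    simp [contactCov, e3]
  refine ⟨by simp [contactCov, e1], by simp [contactCov, e2], e01, by simp [contactCov], ?_⟩
  rw [e01, dB.deriv]
  exact hneg

/-! ## §3 The joint law and its characteristic function -/

/-- **The law of the centred, `√N`-scaled PAIR `((bc − N b)/√N, (tc − N b')/√N)` under `P_{N,y,z}`**, as a measure on `EuclideanSpace ℝ (Fin 2)`.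
[cite: BeatonBousquetMelouDeGierDuminilCopinGuttmann2014, §3.2 (arXiv v5 p. 10: the weights y^{bc} z^{tc}); Durrett2019, §3.2 (lane statement)] -/
def jointLaw (y z : ℝ) (N : ℕ) : Measure (EuclideanSpace ℝ (Fin 2)) :=
  finLawOn (stripPairs 1 N) (fun q => wgt y z N q / stripZ₂ 1 N y z)
    (fun q => !₂[((bottomVisits₀ q.1 q.2 N : ℝ) - N * contactB y z) / Real.sqrt N,
      ((topVisits₀ 1 q.1 q.2 N : ℝ) - N * contactB z y) / Real.sqrt N])

/-- `jointLaw y z N` is a probability measure for `y, z > 0`. [cite: BeatonBousquetMelouDeGierDuminilCopinGuttmann2014, §3.2 (lane plumbing)] -/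
theorem isProbabilityMeasure_jointLaw (hy : 0 < y) (hz : 0 < z) (N : ℕ) : IsProbabilityMeasure (jointLaw y z N) := by
  refine isProbabilityMeasure_finLawOn _ _ (wgt_div_nonneg hy hz N) ?_
  rw [← Finset.sum_div, ← stripZ₂_one_eq_sum_wgt, div_self (stripZ₂_pos 1 N hy hz).ne']

/-- ★ **The characteristic function of the joint law at `ξ` is the characteristic function of the projected law at `1`**:
`charFun(jointLaw)(ξ) = charFun(linLaw ξ₀ ξ₁)(1)` — the Cramér–Wold reduction (`⟨X, ξ⟩ = ξ₀X₀ + ξ₁X₁` is the centred scaled linear statistic).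
[cite: Durrett2019, §3.3 Theorem 3.3.17 (book p. 133: continuity theorem) and §3.10 (Cramér–Wold device; lane statement)] -/
theorem charFun_jointLaw (hy : 0 < y) (hz : 0 < z) (N : ℕ) (ξ : EuclideanSpace ℝ (Fin 2)) :
    charFun (jointLaw y z N) ξ = charFun (linLaw (ξ 0) (ξ 1) y z N) 1 := by
  rw [charFun_apply, charFun_apply_real, jointLaw, integral_finLawOn _ _ (wgt_div_nonneg hy hz N),
    linLaw, integral_finLaw' _ _ (wgt_div_nonneg hy hz N)]
  refine Finset.sum_congr rfl fun q _ => ?_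
  congr 2
  rw [EuclideanSpace.inner_eq_star_dotProduct, star_trivial]
  simp only [dotProduct, Fin.sum_univ_two, Matrix.cons_val_zero, Matrix.cons_val_one, Matrix.cons_val_fin_one]
  push_cast
  ring

/-! ## §4 ★★★★ The joint central limit theorem -/

/-- ★★★★ **THE JOINT CENTRAL LIMIT THEOREM OF THE TWO CONTACT NUMBERS.**  For all `y, z > 0`, the law of the centred, `√N`-scaled pair
`((bc − N·b(y,z))/√N, (tc − N·b(z,y))/√N)` under `P_{N,y,z}` converges weakly, on `ℝ²`, to the centred bivariate Gaussian
`multivariateGaussian 0 Σ` with covariance matrix `Σ = M⁻¹ = [[∂b/∂A, ∂b/∂B], [∂b/∂B, ∂b'/∂B]]` (positive definite, `Σ₁₂ < 0`: the walls compete).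
Proof: Cramér–Wold through characteristic functions — `charFun_jointLaw`, the one-dimensional limits `tendsto_linLaw` read through Lévy's theorem on `ℝ`,
`charFun N(0,Σ)(ξ) = e^{−ξ·Σξ/2} = e^{−H(ξ)/2}` (`contactCov_quadForm`), and Lévy's theorem on `ℝ²`.
[cite: Curtiss1942, Theorem 3; Durrett2019, §3.3 Theorem 3.3.17 (book p. 133); DemboZeitouni2010, §2.3 (lane statement); JansevanRensburg2000, §3.3 (1st ed.); BeatonBousquetMelouDeGierDuminilCopinGuttmann2014, §3.2 Proposition 6 (arXiv v5 p. 10)] -/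
theorem tendsto_jointLaw (hy : 0 < y) (hz : 0 < z) :
    Tendsto (β := ProbabilityMeasure (EuclideanSpace ℝ (Fin 2))) (fun N : ℕ => ⟨jointLaw y z N, isProbabilityMeasure_jointLaw hy hz N⟩) atTop
      (𝓝 ⟨multivariateGaussian 0 (contactCov y z), inferInstance⟩) := by
  refine ProbabilityMeasure.tendsto_of_tendsto_charFun fun ξ => ?_
  simp only [ProbabilityMeasure.coe_mk]
  -- the limit characteristic function
  have hS := posSemidef_contactCov hy hz
  have hlim : charFun (multivariateGaussian 0 (contactCov y z)) ξ = cexp (-(contactHess (ξ 0) (ξ 1) y z : ℝ) / 2) := by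
    rw [charFun_multivariateGaussian hS, inner_zero_right, contactCov_quadForm]
    push_cast
    ring_nf
  -- the one-dimensional limit in the direction `ξ`, read through Lévy's theorem on `ℝ`
  have h1 := (ProbabilityMeasure.tendsto_iff_tendsto_charFun.1 (tendsto_linLaw hy hz (ξ 0) (ξ 1))) 1
  simp only [ProbabilityMeasure.coe_mk] at h1
  have hσ : 0 ≤ contactHess (ξ 0) (ξ 1) y z := by
    by_cases h : (ξ 0, ξ 1) = ((0 : ℝ), (0 : ℝ))
    · obtain ⟨h0, h1'⟩ : ξ 0 = 0 ∧ ξ 1 = 0 := by simpa using h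
      rw [h0, h1']; simp [contactHess]
    · exact (contactHess_pos hy hz h).le
  have hG : charFun (gaussianReal 0 (contactHess (ξ 0) (ξ 1) y z).toNNReal) 1 = cexp (-(contactHess (ξ 0) (ξ 1) y z : ℝ) / 2) := by
    rw [charFun_gaussianReal, Real.coe_toNNReal _ hσ]
    push_cast
    ring_nf
  rw [hlim, ← hG]
  refine h1.congr fun N => ?_
  rw [charFun_jointLaw hy hz]

/-- ★★★ **JOINT CLT, TEST-FUNCTION FORM**: for every bounded continuous `g : ℝ² → ℝ`,
`E_{N,y,z} g((bc − Nb)/√N, (tc − Nb')/√N) → ∫ g dN(0, Σ)`.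
[cite: Durrett2019, §3.2 Theorem 3.2.9 (book p. 123); DemboZeitouni2010, §2.3 (lane statement)] -/
theorem tendsto_integral_jointLaw (hy : 0 < y) (hz : 0 < z) (g : BoundedContinuousFunction (EuclideanSpace ℝ (Fin 2)) ℝ) :
    Tendsto (fun N : ℕ => ∑ q ∈ stripPairs 1 N, wgt y z N q / stripZ₂ 1 N y z
        * g !₂[((bottomVisits₀ q.1 q.2 N : ℝ) - N * contactB y z) / Real.sqrt N, ((topVisits₀ 1 q.1 q.2 N : ℝ) - N * contactB z y) / Real.sqrt N])
      atTop (𝓝 (∫ x, g x ∂multivariateGaussian 0 (contactCov y z))) := by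
  have h := (ProbabilityMeasure.tendsto_iff_forall_integral_tendsto.1 (tendsto_jointLaw hy hz)) g
  simp only [ProbabilityMeasure.coe_mk] at h
  refine h.congr fun N => ?_
  rw [jointLaw, integral_finLawOn _ _ (wgt_div_nonneg hy hz N)]
  simp only [smul_eq_mul]

end WidthOneYZ

end Literature.Probability.RandomPlanarGeometry.SAW.HexBW

end
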